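import Literature.IUT.HodgeTheaters.PiAvatarLocalAmbient
import Literature.IUT.HodgeTheaters.PiAvatarLocalOvergroupUnd
import HarnessLib

/-!
# KIT-INSTANCE-SPEC P5-binding (IV-b, good places): the local datum of a GOOD place `v̲` — `Π_v̲ = Π_{X̲→_K} ∩ augGF⁻¹ G_v̲ ≤
# Π^±_v̲ = Π_{X̲_K} ∩ augGF⁻¹ G_v̲ ≤ Π_{X̲_K}` with its local arrow law, the normaliser step and the `±`-involution
# ([IUTchI] Def 3.1 (f), Ex 3.3 (i), Def 6.1 (ii)(iii), Ex 6.3 (ii); one def — post-freeze additive D13, not a cone member)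

S. Mochizuki, *Inter-universal Teichmüller theory I*, kurims manuscript (May 2020), Def 3.1 (f) p. 63 (`Π_v̲ := Π_{X̲→_v̲}` for good `v̲`),
Ex 3.3 (i) p. 77 (`𝒟_v := ℬ(X̲→_v)⁰`), Def 6.1 (ii) p. 156 (`†𝒟_v → †𝒟_v^±`, «corresponding to `X̲_v`»), Def 6.1 (iii) p. 157 (negative
automorphisms), Ex 6.3 (ii) p. 161 (the `±`-involution over `φ^{Θell}_{•,v̲}`) ([IUTchI] Def 6.1 (ii) p.156) [claim: Mochizuki2012, status: disputed]
(D-0012 claim key, series status DISPUTED — a definition over abc-iut-L5-t2's REAL `InitialThetaData`, under the binders `hS`, the local arrow law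
`Λ` of the place and abc-iut-L5-t1's typed §1 claims `hA : ArrowCoveringClaims`; nothing of the series is asserted, no side is taken on
[IUTchIII] Cor. 3.12).

## What is built
**`InitialThetaData.LocalDatum.ofGood (Gv) (Λ) (hA) : D.LocalDatum CG hS`** — the datum consumed by `baseKitOfData` (p444202) at a good
place with decomposition group `G_v̲ ≤ G_F`: `H := Π_{X̲→_K} ∩ augGF⁻¹ G_v̲` (gen 3 `locModelObj`), `Hund := Π_{X̲_K} ∩ augGF⁻¹ G_v̲` (the
type-(1,l-tors) TWIN `pmUndObjModel`, p441452), `law := Λ`, `normalizer_le_und := normalizer_loc_le_normalizer_pmUnd Λ` (p441452),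
`exists_neg` := the `±`-involution of abc-iut-L5-t4 `exists_localInvolution` (from `hA`, p421621) read through `PiCarrow_le_PiCund` /
`not_mem_PiXund_of_mem_PiCarrow` (p422024); `ofGood_H`, `ofGood_Hund`, `ofGood_locObj` (= `locModelObj Gv`), `ofGood_undObj` (= `pmUndObjModel Gv`).
So at a good place the laws (α)/(β) of `PiAvatarBaseKitLaws` hold with binders `Λ` and `hA` only. No instance, no notation; typed ≠ proved elsewhere.
-/

noncomputable section

namespace Literature.IUT.HodgeTheaters

open CategoryTheory

universe u v w

section LocalDatumGood

variable {F : Type u} {K : Type v} {Fbar : Type w} [Field F] [NumberField F] [Field K] [NumberField K]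
  [Algebra F K] [Field Fbar] [Algebra F Fbar] [Algebra K Fbar]
  {E : WeierstrassCurve F} [E.IsElliptic] {l : ℕ} {Pb : BadPlacePredicates K}
  {D : InitialThetaData F K Fbar E l Pb} {CG : D.geom.pe.CuspGalois} {hS : D.CuspClassesNormaliserStable} [Fact l.Prime]

namespace InitialThetaData

namespace LocalDatum

omit [Fact l.Prime] in
/-- A negative element at a good place: the `±`-involution `c ∈ Π_{C̲→_K} ∖ Π_{X̲→_K}` over `G_v̲` normalises `Π_v̲`, lies in `Π_{C̲_K}` and
outside `Π_{X̲_K}` (abc-iut-L5-t4 `exists_localInvolution`, from abc-iut-L5-t1's `ArrowCoveringClaims`). ([IUTchI] Ex 6.3 (ii) p.161) [claim: Mochizuki2012, status: disputed] -/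
theorem exists_neg_good (hA : D.geom.pe.ArrowCoveringClaims) (Gv : Subgroup (Fbar ≃ₐ[F] Fbar)) :
    ∃ c ∈ Subgroup.normalizer ((D.PiXarrow ⊓ Gv.comap D.augGF : Subgroup D.PiC) : Set D.PiC), c ∈ D.PiCund ∧ c ∉ D.PiXund := by
  obtain ⟨-, c, hc, hcC, hcX, -⟩ := D.exists_localInvolution hA Gv
  have hcX' : c ∉ D.PiXarrow := fun h => hcX ⟨h, (Subgroup.mem_inf.mp hcC).2⟩
  exact ⟨c, hc, D.PiCarrow_le_PiCund (Subgroup.mem_inf.mp hcC).1, D.not_mem_PiXund_of_mem_PiCarrow hA (Subgroup.mem_inf.mp hcC).1 hcX'⟩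

/-- **The local datum of a GOOD place `v̲`** with decomposition group `G_v̲ ≤ G_F`: `Π_v̲ = Π_{X̲→_K} ∩ augGF⁻¹ G_v̲ ≤ Π^±_v̲ = Π_{X̲_K} ∩ augGF⁻¹ G_v̲`,
the local arrow law `Λ`, the normaliser step (p441452) and the `±`-involution (hA). ([IUTchI] Def 6.1 (ii) p.156) [claim: Mochizuki2012, status: disputed] -/
def ofGood (Gv : Subgroup (Fbar ≃ₐ[F] Fbar)) (Λ : D.LocalArrowLaw CG hS (D.PiXarrow ⊓ Gv.comap D.augGF))
    (hA : D.geom.pe.ArrowCoveringClaims) : D.LocalDatum CG hS where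
  H := D.PiXarrow ⊓ Gv.comap D.augGF
  Hund := D.PiXund ⊓ Gv.comap D.augGF
  law := Λ
  le_und := D.PiXarrow_inf_le_PiXund_inf Gv
  und_le := inf_le_left
  normalizer_le_und := D.normalizer_loc_le_normalizer_pmUnd Λ
  exists_neg := exists_neg_good hA Gv

variable (Gv : Subgroup (Fbar ≃ₐ[F] Fbar)) (Λ : D.LocalArrowLaw CG hS (D.PiXarrow ⊓ Gv.comap D.augGF)) (hA : D.geom.pe.ArrowCoveringClaims)

/-- `(ofGood …).H = Π_{X̲→_K} ∩ augGF⁻¹ G_v̲`. ([IUTchI] Def 3.1 (f) p.63) [claim: Mochizuki2012, status: disputed] -/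
@[simp] theorem ofGood_H : (ofGood Gv Λ hA).H = D.PiXarrow ⊓ Gv.comap D.augGF := rfl

/-- `(ofGood …).Hund = Π_{X̲_K} ∩ augGF⁻¹ G_v̲`. ([IUTchI] Def 6.1 (ii) p.156) [claim: Mochizuki2012, status: disputed] -/
@[simp] theorem ofGood_Hund : (ofGood Gv Λ hA).Hund = D.PiXund ⊓ Gv.comap D.augGF := rfl

/-- The local model object is gen 3's `locModelObj Gv` (p423760). ([IUTchI] Ex 3.3 (i) p.77) [claim: Mochizuki2012, status: disputed] -/
theorem ofGood_locObj : (ofGood Gv Λ hA).locObj = D.locModelObj Gv := rfl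

/-- The `±`-object is the type-(1,l-tors) twin `pmUndObjModel Gv` (p441452) — never p432369's `pmObjModel` (RULINGS #55 (1)).
([IUTchI] Def 6.1 (ii) p.156) [claim: Mochizuki2012, status: disputed] -/
theorem ofGood_undObj : (ofGood Gv Λ hA).undObj = D.pmUndObjModel Gv := rfl

end LocalDatum

end InitialThetaData

end LocalDatumGood

end Literature.IUT.HodgeTheaters
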